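import Summits.BirchSwinnertonDyer.Rank1Residual.ManinAdditive.RamifiedTwistManinInvariance
import Summits.BirchSwinnertonDyer.Rank1Residual.ManinAdditive.RamifiedTwistDegreeDichotomy
import Summits.BirchSwinnertonDyer.Rank1Residual.ManinAdditive.RamifiedTwistDegreeLaw
import Summits.BirchSwinnertonDyer.Rank1Residual.ManinConstantOne
import HarnessLib

/-!
# Placement edges of the IMC candidates of cell bsd-f2-manin — PROVED

* `ramifiedTwistManinInvariance_of_maninConstantOne` : Manin's conjecture ⟹ E-imc-2 at every `p`;
* `ramifiedTwistDegreeLawWeak_of_degreeLaw_of_irreducible` : on pairs with `E[p]` irreducible the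
  exact law E-imc-1b gives the oriented weak law's conclusion (pure logic; records the nesting);
* `ramifiedTwistDegreeDichotomy_left_of_lawWeak` : the oriented weak law gives the first inequality of
  the dichotomy on its (oriented, non-CM, odd `p`, `d = p*`) population (pure logic).
The Edixhoven payoff edge (E-imc-2 ∧ EDX ∧ P1/P2/P3 ⟹ `p ∤ c₀`, `p ≥ 11`) is the planner's crux line on
AKR 20483 and is NOT attempted here. Nothing else is claimed; no fact is introduced.
-/

noncomputable section

open scoped MatrixGroups ModularForm

open CongruenceSubgroup WeierstrassCurve
  Literature.NumberTheory.EllipticCurves Literature.NumberTheory.EllipticCurves.ModularForms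
  Summit.BirchSwinnertonDyer.Rank1Residual.ManinConstant

namespace Summit.BirchSwinnertonDyer.Rank1Residual.ManinAdditive

/-- An integer of absolute value `1` has `p`-adic valuation `0` (helper for the Manin edge). -/
private theorem padicValInt_eq_zero_of_abs_eq_one' {p : ℕ} (hp : p.Prime) {c : ℤ} (h : |c| = 1) :
    padicValInt p c = 0 := by
  haveI : Fact p.Prime := ⟨hp⟩
  refine padicValInt.eq_zero_of_not_dvd fun hdvd ↦ ?_
  have h2 : (p : ℤ) ∣ 1 := h ▸ (dvd_abs _ _).mpr hdvd
  have h3 : (p : ℤ) = 1 := Int.eq_one_of_dvd_one (by positivity) h2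
  exact hp.one_lt.ne' (by exact_mod_cast h3)

/-- **Manin ⟹ E-imc-2** at every prime `p` (both optimal data have `|c| = 1`). -/
theorem ramifiedTwistManinInvariance_of_maninConstantOne (hMC : ManinConstantOne) (p : ℕ) :
    RamifiedTwistManinInvariance p := by
  intro W W' _ _ _ _ _ _ D D' hp _ hopt hopt' _ _ _
  rw [padicValInt_eq_zero_of_abs_eq_one' hp (hMC W D hopt),
    padicValInt_eq_zero_of_abs_eq_one' hp (hMC W' D' hopt')]

/-- **E-imc-1b ⟹ the weak law's conclusion on irreducible pairs** (the exact `+1` is the left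
disjunct). -/
theorem ramifiedTwistDegreeLawWeak_of_degreeLaw_of_irreducible {p : ℕ} (h : RamifiedTwistDegreeLaw p)
    (W W' : WeierstrassCurve ℚ) [W.IsElliptic] [W.IsGloballyMinimal] [W'.IsElliptic]
    [W'.IsGloballyMinimal] [NeZero (W.conductorNorm ℤ)] [NeZero (W'.conductorNorm ℤ)]
    (D : ModularParametrizationData W (W.conductorNorm ℤ))
    (D' : ModularParametrizationData W' (W'.conductorNorm ℤ))
    (hp : p.Prime) (hp2 : p ≠ 2)
    (hD : ∀ z ∈ D.L.lattice, ∃ w ∈ periodLattice D.f, z = D.c * w)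
    (hD' : ∀ z ∈ D'.L.lattice, ∃ w ∈ periodLattice D'.f, z = D'.c * w)
    (hN : p ^ 2 ∣ W.conductorNorm ℤ) (hNN : W'.conductorNorm ℤ = W.conductorNorm ℤ)
    (htw : IsIsogenous (W.quadraticTwist ((((-1 : ℤ) ^ (p / 2) * p : ℤ) : ℚ))) W')
    (hirr : W.HasIrreducibleModPGaloisRep p) (hne : ¬ IsIsogenous W W')
    (hor : padicValInt p W.minimalDiscriminantInt < 6) :
    padicValNat p D'.modularDegree = padicValNat p D.modularDegree + 1 ∨
      padicValNat p D'.modularDegree = padicValNat p D.modularDegree :=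
  Or.inl (h W W' D D' hp hp2 hD hD' hN hNN htw hirr hne hor)

/-- **The oriented weak law gives the first dichotomy inequality** on its population (pure logic). -/
theorem padicValNat_modularDegree_le_add_one_of_lawWeak {p : ℕ} (h : RamifiedTwistDegreeLawWeak p)
    (W W' : WeierstrassCurve ℚ) [W.IsElliptic] [W.IsGloballyMinimal] [W'.IsElliptic]
    [W'.IsGloballyMinimal] [NeZero (W.conductorNorm ℤ)] [NeZero (W'.conductorNorm ℤ)]
    (D : ModularParametrizationData W (W.conductorNorm ℤ))
    (D' : ModularParametrizationData W' (W'.conductorNorm ℤ))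
    (hp : p.Prime) (hp2 : p ≠ 2)
    (hD : ∀ z ∈ D.L.lattice, ∃ w ∈ periodLattice D.f, z = D.c * w)
    (hD' : ∀ z ∈ D'.L.lattice, ∃ w ∈ periodLattice D'.f, z = D'.c * w)
    (hN : p ^ 2 ∣ W.conductorNorm ℤ) (hNN : W'.conductorNorm ℤ = W.conductorNorm ℤ)
    (htw : IsIsogenous (W.quadraticTwist ((((-1 : ℤ) ^ (p / 2) * p : ℤ) : ℚ))) W')
    (hne : ¬ IsIsogenous W W') (hor : padicValInt p W.minimalDiscriminantInt < 6) :
    padicValNat p D'.modularDegree ≤ padicValNat p D.modularDegree + 1 ∧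
      padicValNat p D.modularDegree ≤ padicValNat p D'.modularDegree + 1 := by
  rcases h W W' D D' hp hp2 hD hD' hN hNN htw hne hor with h1 | h0 <;> omega

end Summit.BirchSwinnertonDyer.Rank1Residual.ManinAdditive

end
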